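import Literature.MathematicalPhysics.QuantumLattice.XYHelicalTwist
import Literature.MathematicalPhysics.QuantumLattice.HeisenbergOrderTranslationProofs
import Literature.Probability.LatticeModels.TorusFourierProofs
import HarnessLib

/-!
# The momentum-zero order parameter of twisted XY ground states: the engine

Trunk T-QLATTICE; sibling of `XYGaugeTwist.lean` (independent of it) and `XYGaugeTwistWitnesses.lean`.
For the ferromagnetic quantum XY model `xyTorus 2 L n` at EVERY spin and EVERY gauge `ψ`, the
in-plane order parameter of the tracial ground state of the twisted Hamiltonian `R_ψ H R_ψᴴ`,
summed at momentum zero, is controlled by the structure factor of the UNTWISTED ground state away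
from zero momentum, provided the phase `e^{iψ}` averages to zero. Finite-dimensional matrix algebra
(folklore) plus one consequence of the tree's Kennedy–Lieb–Shastry infrared bound.

## Contents (namespace `XYGaugeTwist`)

* `raiseWave L n f = Σ_x f_x S⁺_x`, `cexpGauge L ψ x = e^{iψ_x}`; the twisted observable
  `R_ψᴴ X_{ab} R_ψ = ½(f_a conj f_b S⁺_aS⁻_b + conj f_a f_b S⁻_aS⁺_b)` and
  `Σ_{a,b} R_ψᴴ X_{ab} R_ψ = ½(B_f B_fᴴ + B_fᴴ B_f)` (`sum_sum_helixTwist_conj_xyPair`).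
* Character expansion `f = Σ_k a_k χ_k` (`fourierCoeff`, from `TorusFourierProofs`), Parseval
  `Σ_k ‖a_k‖² = 1` for unimodular `f`; translation invariance of the XY torus and of its tracial
  ground state (`xyTorus_submatrix_comp_addRight`, `gsf_submatrix_addRight`); momentum conservation
  `ω(B_{χ_k}B_{χ_{k'}}ᴴ) = 0`, `k ≠ k'`; diagonalisation `ω(B_fB_fᴴ) = Σ_k ‖a_k‖² ω(B_{χ_k}B_{χ_k}ᴴ)`.
* Modes: `B_{χ_k} = a_k + i b_k` with Hermitian `a_k = C⁰_k - D¹_k`, `b_k = D⁰_k + C¹_k`, and the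
  positivity estimate `Re ω(B_{χ_k}B_{χ_k}ᴴ) + Re ω(B_{χ_k}ᴴB_{χ_k}) ≤ 8 L² ĝ⁰(k)`
  (`re_gsf_charWave_sum_le`; uses `xyStructureFactor_eq_modes` and `G¹ = G⁰`, no spin flip).
* THE ENGINE `twisted_order_le`: `Σ_x e^{iψ_x} = 0` and `ĝ⁰(k) ≤ G` (`k ≠ 0`) imply
  `Σ_{x,y} Re ω_{R_ψHR_ψᴴ}(X_{xy}) ≤ 8 L² G`.
* `xyStructureFactor_le_of_ne_zero`: `ĝ⁰(q) ≤ n·(2k)/5` for `q ≠ 0` on even tori `2k ≥ 4`, every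
  spin `≥ 1/2` (`kls_xy_infraredBound_ground_holds`, `|e_α| ≤ S²`, `E_q ≥ 1 - cos(2π/L) ≥ 8/L²`).

## Sources

* T. Kennedy, E. H. Lieb, B. S. Shastry, PRL 61 (1988) 2582 (`KLS1988PRL`), eq. (4): the infrared
  bound, consumed through `kls_xy_infraredBound_ground_holds`.
* S. Friedli, Y. Velenik, *Statistical Mechanics of Lattice Systems* (2017), §10.4: discrete Fourier
  analysis on `(ℤ/Lℤ)^d` (through `TorusFourierProofs`).
* H. Tasaki (2020), §2.1: tracial ground states and their symmetries.
-/

noncomputable section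

open Matrix Complex Finset
open scoped ComplexOrder
open Literature.MathematicalPhysics.QuantumLattice Literature.Probability.LatticeModels

namespace Literature.MathematicalPhysics.QuantumLattice

namespace XYGaugeTwist

/-! ### The raising wave and the twisted observable -/

section Engine

variable (L : ℕ) [NeZero L] (n : ℕ)

/-- The raising wave `B_f = Σ_x f_x S⁺_x`. [folklore] -/
def raiseWave (f : TorusSite 2 L → ℂ) : Op (TorusSite 2 L) (n + 1) := ∑ x, f x • siteRaise n x

/-- `B_fᴴ = Σ_x conj(f_x) S⁻_x`. [folklore] -/
theorem raiseWave_conjTranspose (f : TorusSite 2 L → ℂ) :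
    (raiseWave L n f)ᴴ = ∑ x, star (f x) • siteLower n x := by
  rw [raiseWave, conjTranspose_sum]
  refine Finset.sum_congr rfl fun x _ => ?_
  rw [conjTranspose_smul, siteRaise_conjTranspose]

/-- `B_f B_fᴴ = Σ_{x,y} f_x conj(f_y) S⁺_xS⁻_y`. [folklore] -/
theorem raiseWave_mul_conjTranspose (f : TorusSite 2 L → ℂ) :
    raiseWave L n f * (raiseWave L n f)ᴴ = ∑ x, ∑ y, (f x * star (f y)) • raiseLowerPair n x y := by
  rw [raiseWave_conjTranspose, raiseWave, Finset.sum_mul_sum]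
  refine Finset.sum_congr rfl fun x _ => Finset.sum_congr rfl fun y _ => ?_
  rw [smul_mul_smul_comm, raiseLowerPair]

/-- `B_fᴴ B_f = Σ_{x,y} conj(f_x) f_y S⁻_xS⁺_y`. [folklore] -/
theorem conjTranspose_mul_raiseWave (f : TorusSite 2 L → ℂ) :
    (raiseWave L n f)ᴴ * raiseWave L n f = ∑ x, ∑ y, (star (f x) * f y) • lowerRaisePair n x y := by
  rw [raiseWave_conjTranspose, raiseWave, Finset.sum_mul_sum]
  refine Finset.sum_congr rfl fun x _ => Finset.sum_congr rfl fun y _ => ?_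
  rw [smul_mul_smul_comm, lowerRaisePair]

/-- The unimodular function `e^{iψ}` of a gauge. [folklore] -/
def cexpGauge (ψ : TorusSite 2 L → ℝ) (x : TorusSite 2 L) : ℂ := Complex.exp ((ψ x : ℂ) * I)

/-- **The twisted in-plane observable**: `R_ψᴴ X_{ab} R_ψ = ½(f_a conj f_b S⁺_aS⁻_b + conj f_a f_b S⁻_aS⁺_b)`,
`f = e^{iψ}`. [folklore] -/
theorem helixTwist_conjTranspose_mul_xyPair_mul (ψ : TorusSite 2 L → ℝ) (a b : TorusSite 2 L) :
    (helixTwist n ψ)ᴴ * xyPair n a b * helixTwist n ψ =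
      (1 / 2 : ℂ) • ((cexpGauge L ψ a * star (cexpGauge L ψ b)) • raiseLowerPair n a b +
        (star (cexpGauge L ψ a) * cexpGauge L ψ b) • lowerRaisePair n a b) := by
  have hR : helixTwist n ψ = (helixTwist n (-ψ))ᴴ := by rw [helixTwist_conjTranspose, neg_neg]
  rw [helixTwist_conjTranspose]
  conv_lhs => rw [hR]
  rw [xyPair_eq, mul_smul_comm, smul_mul_assoc, mul_add, add_mul, helixTwist_conj_raiseLowerPair,
    helixTwist_conj_lowerRaisePair]
  simp only [Pi.neg_apply, cexpGauge, star_cexp_mul_I]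
  have e1 : Complex.exp (((-ψ b - -ψ a : ℝ) : ℂ) * I) =
      Complex.exp ((ψ a : ℂ) * I) * Complex.exp (((-ψ b : ℝ) : ℂ) * I) := by
    rw [← Complex.exp_add]; push_cast; ring_nf
  have e2 : Complex.exp (((-ψ a - -ψ b : ℝ) : ℂ) * I) =
      Complex.exp (((-ψ a : ℝ) : ℂ) * I) * Complex.exp ((ψ b : ℂ) * I) := by
    rw [← Complex.exp_add]; push_cast; ring_nf
  rw [e1, e2]

/-- **The summed twisted observable is a sum of two squares**:
`Σ_{a,b} R_ψᴴ X_{ab} R_ψ = ½ (B_f B_fᴴ + B_fᴴ B_f)`, `f = e^{iψ}`. [folklore] -/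
theorem sum_sum_helixTwist_conj_xyPair (ψ : TorusSite 2 L → ℝ) :
    ∑ a, ∑ b, (helixTwist n ψ)ᴴ * xyPair n a b * helixTwist n ψ =
      (1 / 2 : ℂ) • (raiseWave L n (cexpGauge L ψ) * (raiseWave L n (cexpGauge L ψ))ᴴ +
        (raiseWave L n (cexpGauge L ψ))ᴴ * raiseWave L n (cexpGauge L ψ)) := by
  simp_rw [helixTwist_conjTranspose_mul_xyPair_mul, ← Finset.smul_sum, smul_add,
    Finset.sum_add_distrib]
  rw [raiseWave_mul_conjTranspose, conjTranspose_mul_raiseWave, smul_add]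

/-! #### Fourier expansion of the wave -/

/-- The normalised Fourier coefficient `a_k = L⁻² 𝓕f(k)`. [folklore] -/
def fourierCoeff (f : TorusSite 2 L → ℂ) (k : TorusSite 2 L) : ℂ :=
  ((L : ℂ) ^ 2)⁻¹ * torusFourier f k

/-- Character expansion `f(x) = Σ_k a_k χ_k(x)`. [folklore] -/
theorem eq_sum_fourierCoeff_mul_torusChar (f : TorusSite 2 L → ℂ) (x : TorusSite 2 L) :
    f x = ∑ k, fourierCoeff L f k * torusChar k x := by
  have h := torusFourier_inversion_holds (d := 2) (L := L) f
  conv_lhs => rw [← h]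
  rw [torusFourierInv_eq_sum_torusChar, Finset.mul_sum]
  refine Finset.sum_congr rfl fun k _ => ?_
  rw [fourierCoeff]
  ring

/-- `B_f = Σ_k a_k B_{χ_k}`. [folklore] -/
theorem raiseWave_eq_sum_fourierCoeff (f : TorusSite 2 L → ℂ) :
    raiseWave L n f = ∑ k, fourierCoeff L f k • raiseWave L n (torusChar k) := by
  have h : ∀ x, f x • siteRaise n x = ∑ k, fourierCoeff L f k • (torusChar k x • siteRaise n x) := by
    intro x
    conv_lhs => rw [eq_sum_fourierCoeff_mul_torusChar L f x]
    rw [Finset.sum_smul]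
    refine Finset.sum_congr rfl fun k _ => ?_
    rw [smul_smul]
  rw [raiseWave]
  simp_rw [h]
  rw [Finset.sum_comm]
  refine Finset.sum_congr rfl fun k _ => ?_
  rw [raiseWave, Finset.smul_sum]

/-- `a_0 = L⁻² Σ_x f(x)`. [folklore] -/
theorem fourierCoeff_zero (f : TorusSite 2 L → ℂ) :
    fourierCoeff L f 0 = ((L : ℂ) ^ 2)⁻¹ * ∑ x, f x := by
  rw [fourierCoeff, torusFourier_apply_zero]

/-- Parseval for the normalised coefficients of a unimodular function: `Σ_k ‖a_k‖² = 1`. [folklore] -/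
theorem sum_norm_sq_fourierCoeff {f : TorusSite 2 L → ℂ} (hf : ∀ x, ‖f x‖ = 1) :
    ∑ k, ‖fourierCoeff L f k‖ ^ 2 = 1 := by
  have hP := torusFourier_plancherel_holds (d := 2) (L := L) f
  have hL : (L : ℝ) ≠ 0 := by exact_mod_cast NeZero.ne L
  have hcard : ∑ x : TorusSite 2 L, ‖f x‖ ^ 2 = (L : ℝ) ^ 2 := by
    simp_rw [hf, one_pow]
    rw [Finset.sum_const, Finset.card_univ, Fintype.card_pi, Finset.prod_const, ZMod.card,
      Finset.card_univ, Fintype.card_fin]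
    simp
  rw [hcard] at hP
  have hk : ∀ k, ‖fourierCoeff L f k‖ ^ 2 = ((L : ℝ) ^ 2)⁻¹ ^ 2 * ‖torusFourier f k‖ ^ 2 := by
    intro k
    rw [fourierCoeff, norm_mul, norm_inv, norm_pow, Complex.norm_natCast, mul_pow]
  simp_rw [hk]
  rw [← Finset.mul_sum, hP]
  field_simp

/-! #### Translation invariance of the tracial ground state of the XY torus -/

/-- The XY Hamiltonian of the torus is translation invariant (relabelling `x ↦ x + v`). [folklore] -/
theorem xyTorus_submatrix_comp_addRight (v : TorusSite 2 L) :
    (xyTorus 2 L n).submatrix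
        (fun σ : TensorIndex (TorusSite 2 L) (n + 1) => σ ∘ Equiv.addRight v)
        (fun σ => σ ∘ Equiv.addRight v) = xyTorus 2 L n := by
  rw [xyTorus_eq_bondSum, submatrix_finset_sum]
  refine Finset.sum_nbij' (Sym2.map (Equiv.addRight v)) (Sym2.map (Equiv.addRight v).symm)
    (fun e he => ?_) (fun e he => ?_) (fun e _ => ?_) (fun e _ => ?_) (fun e _ => ?_)
  · exact (sym2Map_addRight_mem_edgeFinset_torusGraph L v e).2 he
  · rw [Equiv.addRight_symm]
    exact (sym2Map_addRight_mem_edgeFinset_torusGraph L (-v) e).2 he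
  · simp only [Sym2.map_map, Equiv.symm_comp_self, Sym2.map_id', id_eq]
  · simp only [Sym2.map_map, Equiv.self_comp_symm, Sym2.map_id', id_eq]
  · induction e using Sym2.ind with
    | h x y =>
      simp only [Sym2.map_mk, Sym2.lift_mk, submatrix_add, submatrix_smul, Pi.add_apply,
        Pi.smul_apply, spinBond_submatrix_comp]

/-- Translation invariance of the tracial ground state of the XY torus. [folklore] -/
theorem gsf_submatrix_addRight (v : TorusSite 2 L) (O : Op (TorusSite 2 L) (n + 1)) :
    (xyTorus 2 L n).groundStateFunctional
        (O.submatrix (fun σ => σ ∘ Equiv.addRight v) (fun σ => σ ∘ Equiv.addRight v)) =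
      (xyTorus 2 L n).groundStateFunctional O :=
  groundStateFunctional_submatrix_comp (xyTorus_isHermitian 2 L n) (Equiv.addRight v)
    (xyTorus_submatrix_comp_addRight L n v) O

/-- A character wave is a translation eigenvector: `τ_v B_{χ_k} = conj χ_k(v) · B_{χ_k}`. [folklore] -/
theorem raiseWave_torusChar_submatrix (k v : TorusSite 2 L) :
    (raiseWave L n (torusChar k)).submatrix (fun σ => σ ∘ Equiv.addRight v)
        (fun σ => σ ∘ Equiv.addRight v) =
      star (torusChar k v) • raiseWave L n (torusChar k) := by
  rw [raiseWave, submatrix_finset_sum]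
  simp_rw [submatrix_smul, Pi.smul_apply, siteRaise, onSite_submatrix_comp, Equiv.coe_addRight]
  rw [← Equiv.sum_comp (Equiv.subRight v), Finset.smul_sum]
  refine Finset.sum_congr rfl fun y _ => ?_
  simp only [Equiv.subRight_apply, sub_add_cancel]
  rw [torusChar_sub_right, smul_smul, mul_comm, Complex.star_def]

/-- The conjugate wave: `τ_v B_{χ_k}ᴴ = χ_k(v) · B_{χ_k}ᴴ`. [folklore] -/
theorem raiseWave_torusChar_conjTranspose_submatrix (k v : TorusSite 2 L) :
    (raiseWave L n (torusChar k))ᴴ.submatrix (fun σ => σ ∘ Equiv.addRight v)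
        (fun σ => σ ∘ Equiv.addRight v) =
      torusChar k v • (raiseWave L n (torusChar k))ᴴ := by
  rw [← conjTranspose_submatrix, raiseWave_torusChar_submatrix, conjTranspose_smul, star_star]

/-- **Momentum conservation**: `ω(B_{χ_k} B_{χ_{k'}}ᴴ) = 0` for `k ≠ k'`. [folklore] -/
theorem gsf_raiseWave_mul_conjTranspose_eq_zero {k k' : TorusSite 2 L} (hk : k ≠ k') :
    (xyTorus 2 L n).groundStateFunctional
        (raiseWave L n (torusChar k) * (raiseWave L n (torusChar k'))ᴴ) = 0 := by
  set Ω : ℂ := (xyTorus 2 L n).groundStateFunctional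
      (raiseWave L n (torusChar k) * (raiseWave L n (torusChar k'))ᴴ) with hΩ
  have h : ∀ v, Ω = (star (torusChar k v) * torusChar k' v) * Ω := by
    intro v
    have h1 := gsf_submatrix_addRight L n v
      (raiseWave L n (torusChar k) * (raiseWave L n (torusChar k'))ᴴ)
    rw [Matrix.submatrix_mul _ _ _
        (fun σ : TensorIndex (TorusSite 2 L) (n + 1) => σ ∘ Equiv.addRight v) _
        (bijective_comp_equiv (q := n + 1) _),
      raiseWave_torusChar_submatrix, raiseWave_torusChar_conjTranspose_submatrix,
      smul_mul_smul_comm, LinearMap.map_smul, smul_eq_mul] at h1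
    rw [← hΩ] at h1
    exact h1.symm
  have hsum : ∑ v : TorusSite 2 L, star (torusChar k v) * torusChar k' v = 0 := by
    have e : ∀ v : TorusSite 2 L, star (torusChar k v) * torusChar k' v = torusChar (k' - k) v := by
      intro v
      rw [torusChar_sub_left, mul_comm, Complex.star_def]
    simp_rw [e, sum_torusChar_right, sub_eq_zero]
    rw [if_neg (Ne.symm hk)]
  have e1 : ∑ _v : TorusSite 2 L, Ω = (Fintype.card (TorusSite 2 L) : ℂ) * Ω := by
    rw [Finset.sum_const, Finset.card_univ, nsmul_eq_mul]
  have e2 : ∑ v : TorusSite 2 L, Ω = (∑ v : TorusSite 2 L, star (torusChar k v) * torusChar k' v) * Ω := by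
    rw [Finset.sum_mul]
    exact Finset.sum_congr rfl fun v _ => h v
  rw [hsum, zero_mul, e1] at e2
  have hc : (Fintype.card (TorusSite 2 L) : ℂ) ≠ 0 := by
    exact_mod_cast Fintype.card_ne_zero
  exact (mul_eq_zero.1 e2).resolve_left hc

/-- **Momentum conservation** (conjugate form): `ω(B_{χ_k}ᴴ B_{χ_{k'}}) = 0` for `k ≠ k'`. [folklore] -/
theorem gsf_conjTranspose_mul_raiseWave_eq_zero {k k' : TorusSite 2 L} (hk : k ≠ k') :
    (xyTorus 2 L n).groundStateFunctional
        ((raiseWave L n (torusChar k))ᴴ * raiseWave L n (torusChar k')) = 0 := by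
  set Ω : ℂ := (xyTorus 2 L n).groundStateFunctional
      ((raiseWave L n (torusChar k))ᴴ * raiseWave L n (torusChar k')) with hΩ
  have h : ∀ v, Ω = (torusChar k v * star (torusChar k' v)) * Ω := by
    intro v
    have h1 := gsf_submatrix_addRight L n v
      ((raiseWave L n (torusChar k))ᴴ * raiseWave L n (torusChar k'))
    rw [Matrix.submatrix_mul _ _ _
        (fun σ : TensorIndex (TorusSite 2 L) (n + 1) => σ ∘ Equiv.addRight v) _
        (bijective_comp_equiv (q := n + 1) _),
      raiseWave_torusChar_submatrix, raiseWave_torusChar_conjTranspose_submatrix,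
      smul_mul_smul_comm, LinearMap.map_smul, smul_eq_mul] at h1
    rw [← hΩ] at h1
    exact h1.symm
  have hsum : ∑ v : TorusSite 2 L, torusChar k v * star (torusChar k' v) = 0 := by
    have e : ∀ v : TorusSite 2 L, torusChar k v * star (torusChar k' v) = torusChar (k - k') v := by
      intro v
      rw [torusChar_sub_left, Complex.star_def]
    simp_rw [e, sum_torusChar_right, sub_eq_zero]
    rw [if_neg hk]
  have e1 : ∑ _v : TorusSite 2 L, Ω = (Fintype.card (TorusSite 2 L) : ℂ) * Ω := by
    rw [Finset.sum_const, Finset.card_univ, nsmul_eq_mul]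
  have e2 : ∑ v : TorusSite 2 L, Ω = (∑ v : TorusSite 2 L, torusChar k v * star (torusChar k' v)) * Ω := by
    rw [Finset.sum_mul]
    exact Finset.sum_congr rfl fun v _ => h v
  rw [hsum, zero_mul, e1] at e2
  have hc : (Fintype.card (TorusSite 2 L) : ℂ) ≠ 0 := by
    exact_mod_cast Fintype.card_ne_zero
  exact (mul_eq_zero.1 e2).resolve_left hc

/-- **Diagonalisation**: `ω(B_f B_fᴴ) = Σ_k ‖a_k‖² ω(B_{χ_k} B_{χ_k}ᴴ)`. [folklore] -/
theorem gsf_raiseWave_mul_conjTranspose (f : TorusSite 2 L → ℂ) :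
    (xyTorus 2 L n).groundStateFunctional (raiseWave L n f * (raiseWave L n f)ᴴ) =
      ∑ k, ((‖fourierCoeff L f k‖ ^ 2 : ℝ) : ℂ) *
        (xyTorus 2 L n).groundStateFunctional
          (raiseWave L n (torusChar k) * (raiseWave L n (torusChar k))ᴴ) := by
  rw [raiseWave_eq_sum_fourierCoeff L n f, conjTranspose_sum, Finset.sum_mul_sum, map_sum]
  refine Finset.sum_congr rfl fun k _ => ?_
  rw [map_sum, Finset.sum_eq_single k]
  · rw [conjTranspose_smul, smul_mul_smul_comm, LinearMap.map_smul, smul_eq_mul,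
      Complex.star_def, Complex.mul_conj, Complex.normSq_eq_norm_sq]
  · intro k' _ hk'
    rw [conjTranspose_smul, smul_mul_smul_comm, LinearMap.map_smul,
      gsf_raiseWave_mul_conjTranspose_eq_zero L n (Ne.symm hk'), smul_zero]
  · intro h; exact absurd (Finset.mem_univ k) h

/-- **Diagonalisation** (conjugate form): `ω(B_fᴴ B_f) = Σ_k ‖a_k‖² ω(B_{χ_k}ᴴ B_{χ_k})`. [folklore] -/
theorem gsf_conjTranspose_mul_raiseWave (f : TorusSite 2 L → ℂ) :
    (xyTorus 2 L n).groundStateFunctional ((raiseWave L n f)ᴴ * raiseWave L n f) =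
      ∑ k, ((‖fourierCoeff L f k‖ ^ 2 : ℝ) : ℂ) *
        (xyTorus 2 L n).groundStateFunctional
          ((raiseWave L n (torusChar k))ᴴ * raiseWave L n (torusChar k)) := by
  rw [raiseWave_eq_sum_fourierCoeff L n f, conjTranspose_sum, Finset.sum_mul_sum, map_sum]
  refine Finset.sum_congr rfl fun k _ => ?_
  rw [map_sum, Finset.sum_eq_single k]
  · rw [conjTranspose_smul, smul_mul_smul_comm, LinearMap.map_smul, smul_eq_mul,
      Complex.star_def, mul_comm (starRingEnd ℂ _), Complex.mul_conj, Complex.normSq_eq_norm_sq]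
  · intro k' _ hk'
    rw [conjTranspose_smul, smul_mul_smul_comm, LinearMap.map_smul,
      gsf_conjTranspose_mul_raiseWave_eq_zero L n (Ne.symm hk'), smul_zero]
  · intro h; exact absurd (Finset.mem_univ k) h

end Engine


/-! #### The modes of a character wave and the structure-factor bound -/

section Modes

variable (L : ℕ) [NeZero L] (n : ℕ)

/-- A real wave `Σ_x a_x Sᵅ_x`. [folklore] -/
def realWave (a : TorusSite 2 L → ℝ) (α : Fin 3) : Op (TorusSite 2 L) (n + 1) :=
  ∑ x, (a x : ℂ) • siteSpin n x α

/-- Real waves are Hermitian. [folklore] -/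
theorem realWave_isHermitian (a : TorusSite 2 L → ℝ) (α : Fin 3) :
    (realWave L n a α).IsHermitian := by
  unfold realWave
  refine (isSelfAdjoint_sum _ fun x _ => Matrix.IsHermitian.isSelfAdjoint ?_).isHermitian
  rw [IsHermitian, conjTranspose_smul, Complex.star_def, Complex.conj_ofReal,
    (siteSpin_isHermitian n x α).eq]

/-- `Re ω(A_a A_b) = Σ_{x,y} a_x b_y Gᵅ(x,y)` for real waves of the same component. [folklore] -/
theorem re_gsf_realWave_mul_realWave (a b : TorusSite 2 L → ℝ) (α : Fin 3) :
    ((xyTorus 2 L n).groundStateFunctional (realWave L n a α * realWave L n b α)).re =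
      ∑ x, ∑ y, a x * b y * xyGroundCorr α L n x y := by
  rw [realWave, realWave, Finset.sum_mul_sum, map_sum, Complex.re_sum]
  refine Finset.sum_congr rfl fun x _ => ?_
  rw [map_sum, Complex.re_sum]
  refine Finset.sum_congr rfl fun y _ => ?_
  rw [smul_mul_smul_comm, LinearMap.map_smul, smul_eq_mul, xyGroundCorr_of_neZero,
    ← Complex.ofReal_mul, Complex.re_ofReal_mul]

/-- `U(1)` symmetry: the component-`1` squares equal the component-`0` squares. [folklore] -/
theorem re_gsf_realWave_sq_one_eq_zero (a : TorusSite 2 L → ℝ) :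
    ((xyTorus 2 L n).groundStateFunctional (realWave L n a 1 * realWave L n a 1)).re =
      ((xyTorus 2 L n).groundStateFunctional (realWave L n a 0 * realWave L n a 0)).re := by
  rw [re_gsf_realWave_mul_realWave, re_gsf_realWave_mul_realWave]
  simp_rw [xy_groundCorr_two_eq_one_holds 2 L n]

/-- The cosine mode of component `0` is the tree's `xyCosMode`. [folklore] -/
theorem realWave_cos_zero (k : TorusSite 2 L) :
    realWave L n (fun x => Real.cos (torusPhase L k x)) 0 = xyCosMode L n k := rfl

/-- The sine mode of component `0` is the tree's `xySinMode`. [folklore] -/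
theorem realWave_sin_zero (k : TorusSite 2 L) :
    realWave L n (fun x => Real.sin (torusPhase L k x)) 0 = xySinMode L n k := rfl

/-- **The mode sum is the structure factor**: `Re ω(C_k²) + Re ω(D_k²) = L² ĝ⁰(k)`. [folklore] -/
theorem re_gsf_cos_sq_add_sin_sq (k : TorusSite 2 L) :
    ((xyTorus 2 L n).groundStateFunctional
        (realWave L n (fun x => Real.cos (torusPhase L k x)) 0 *
          realWave L n (fun x => Real.cos (torusPhase L k x)) 0)).re +
      ((xyTorus 2 L n).groundStateFunctional
        (realWave L n (fun x => Real.sin (torusPhase L k x)) 0 *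
          realWave L n (fun x => Real.sin (torusPhase L k x)) 0)).re =
      xyStructureFactor 0 L n k * (L : ℝ) ^ 2 := by
  rw [realWave_cos_zero, realWave_sin_zero, xyStructureFactor_eq_modes]

/-- `χ_k(x) = cos(p·x) + i sin(p·x)`. [folklore] -/
theorem torusChar_eq_cos_add_sin (k x : TorusSite 2 L) :
    torusChar k x = (Real.cos (torusPhase L k x) : ℂ) + (Real.sin (torusPhase L k x) : ℂ) * I := by
  change (∏ j, (ZMod.stdAddChar (k j * x j) : ℂ)) = _
  rw [Literature.MathematicalPhysics.QuantumLattice.torusChar_eq_exp, Complex.exp_mul_I,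
    ← Complex.ofReal_cos, ← Complex.ofReal_sin]

/-- The Hermitian part `a_k = C⁰_k - D¹_k` of the character wave. [folklore] -/
def modeA (k : TorusSite 2 L) : Op (TorusSite 2 L) (n + 1) :=
  realWave L n (fun x => Real.cos (torusPhase L k x)) 0 -
    realWave L n (fun x => Real.sin (torusPhase L k x)) 1

/-- The anti-Hermitian part `b_k = D⁰_k + C¹_k` of the character wave (divided by `i`). [folklore] -/
def modeB (k : TorusSite 2 L) : Op (TorusSite 2 L) (n + 1) :=
  realWave L n (fun x => Real.sin (torusPhase L k x)) 0 +
    realWave L n (fun x => Real.cos (torusPhase L k x)) 1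

/-- `a_k` is Hermitian. [folklore] -/
theorem modeA_isHermitian (k : TorusSite 2 L) : (modeA L n k).IsHermitian :=
  (realWave_isHermitian L n _ 0).sub (realWave_isHermitian L n _ 1)

/-- `b_k` is Hermitian. [folklore] -/
theorem modeB_isHermitian (k : TorusSite 2 L) : (modeB L n k).IsHermitian :=
  (realWave_isHermitian L n _ 0).add (realWave_isHermitian L n _ 1)

/-- **Cartesian decomposition of the character wave**: `B_{χ_k} = a_k + i b_k`. [folklore] -/
theorem raiseWave_torusChar_eq (k : TorusSite 2 L) :
    raiseWave L n (torusChar k) = modeA L n k + I • modeB L n k := by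
  have h : ∀ x : TorusSite 2 L, torusChar k x • siteRaise n x =
      (((Real.cos (torusPhase L k x) : ℂ) • siteSpin n x 0 -
        (Real.sin (torusPhase L k x) : ℂ) • siteSpin n x 1) +
      I • ((Real.sin (torusPhase L k x) : ℂ) • siteSpin n x 0 +
        (Real.cos (torusPhase L k x) : ℂ) • siteSpin n x 1)) := by
    intro x
    rw [torusChar_eq_cos_add_sin, siteRaise_eq]
    generalize (Real.cos (torusPhase L k x) : ℂ) = c
    generalize (Real.sin (torusPhase L k x) : ℂ) = s
    simp only [smul_add, add_smul, smul_smul]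
    match_scalars
    · ring
    · linear_combination s * Complex.I_sq
  rw [raiseWave, modeA, modeB, realWave, realWave, realWave, realWave]
  simp_rw [h]
  rw [Finset.sum_add_distrib, Finset.sum_sub_distrib, ← Finset.smul_sum, Finset.sum_add_distrib]

/-- `B_{χ_k}ᴴ = a_k - i b_k`. [folklore] -/
theorem raiseWave_torusChar_conjTranspose_eq (k : TorusSite 2 L) :
    (raiseWave L n (torusChar k))ᴴ = modeA L n k - I • modeB L n k := by
  rw [raiseWave_torusChar_eq, conjTranspose_add, conjTranspose_smul, (modeA_isHermitian L n k).eq,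
    (modeB_isHermitian L n k).eq, Complex.star_def, Complex.conj_I, neg_smul, sub_eq_add_neg]

/-- `M Mᴴ + Mᴴ M = 2(a² + b²)` for `M = a + ib`. [folklore] -/
theorem cartesian_sq_identity (a b : Op (TorusSite 2 L) (n + 1)) :
    (a + I • b) * (a - I • b) + (a - I • b) * (a + I • b) = (2 : ℂ) • (a * a + b * b) := by
  simp only [mul_add, add_mul, mul_sub, sub_mul, smul_mul_assoc, mul_smul_comm]
  match_scalars <;> first | ring1 | linear_combination (-2 : ℂ) * Complex.I_sq

/-- `(C - D)² + (C + D)² = 2(C² + D²)`. [folklore] -/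
theorem sub_sq_add_add_sq (C D : Op (TorusSite 2 L) (n + 1)) :
    (C - D) * (C - D) + (C + D) * (C + D) = (2 : ℂ) • (C * C + D * D) := by
  simp only [mul_add, add_mul, mul_sub, sub_mul]
  module

/-- `0 ≤ Re ω(Oᴴ O)`. [folklore] -/
theorem re_gsf_conjTranspose_mul_self_nonneg (A O : Op (TorusSite 2 L) (n + 1)) :
    0 ≤ (A.groundStateFunctional (Oᴴ * O)).re :=
  (Complex.nonneg_iff.mp (groundStateFunctional_nonneg A O)).1

/-- `0 ≤ Re ω(O Oᴴ)`. [folklore] -/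
theorem re_gsf_mul_conjTranspose_self_nonneg (A O : Op (TorusSite 2 L) (n + 1)) :
    0 ≤ (A.groundStateFunctional (O * Oᴴ)).re := by
  have h := groundStateFunctional_nonneg A Oᴴ
  rw [conjTranspose_conjTranspose] at h
  exact (Complex.nonneg_iff.mp h).1

/-- **The structure-factor bound for a character wave**:
`Re ω(B_{χ_k}B_{χ_k}ᴴ) + Re ω(B_{χ_k}ᴴB_{χ_k}) ≤ 8 L² ĝ⁰(k)`. [folklore] -/
theorem re_gsf_charWave_sum_le (k : TorusSite 2 L) :
    ((xyTorus 2 L n).groundStateFunctional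
        (raiseWave L n (torusChar k) * (raiseWave L n (torusChar k))ᴴ)).re +
      ((xyTorus 2 L n).groundStateFunctional
        ((raiseWave L n (torusChar k))ᴴ * raiseWave L n (torusChar k))).re ≤
      8 * (L : ℝ) ^ 2 * xyStructureFactor 0 L n k := by
  set H := xyTorus 2 L n with hH
  set C0 := realWave L n (fun x => Real.cos (torusPhase L k x)) 0 with hC0
  set S0 := realWave L n (fun x => Real.sin (torusPhase L k x)) 0 with hS0
  set C1 := realWave L n (fun x => Real.cos (torusPhase L k x)) 1 with hC1
  set S1 := realWave L n (fun x => Real.sin (torusPhase L k x)) 1 with hS1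
  have hA : modeA L n k = C0 - S1 := rfl
  have hB : modeB L n k = S0 + C1 := rfl
  -- the sum of the two squares
  have hsum : raiseWave L n (torusChar k) * (raiseWave L n (torusChar k))ᴴ +
      (raiseWave L n (torusChar k))ᴴ * raiseWave L n (torusChar k) =
      (2 : ℂ) • (modeA L n k * modeA L n k + modeB L n k * modeB L n k) := by
    rw [raiseWave_torusChar_conjTranspose_eq, raiseWave_torusChar_eq]
    exact cartesian_sq_identity L n _ _
  have e1 : (H.groundStateFunctional
        (raiseWave L n (torusChar k) * (raiseWave L n (torusChar k))ᴴ)).re +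
      (H.groundStateFunctional
        ((raiseWave L n (torusChar k))ᴴ * raiseWave L n (torusChar k))).re =
      2 * ((H.groundStateFunctional (modeA L n k * modeA L n k)).re +
        (H.groundStateFunctional (modeB L n k * modeB L n k)).re) := by
    rw [← Complex.add_re, ← map_add, hsum, LinearMap.map_smul, smul_eq_mul, map_add, mul_add,
      Complex.add_re]
    simp only [Complex.mul_re, Complex.re_ofNat, Complex.im_ofNat, zero_mul, sub_zero]
    ring
  -- `a² ≤ 2 C0² + 2 S1²`, `b² ≤ 2 S0² + 2 C1²`
  have hAsq : (H.groundStateFunctional (modeA L n k * modeA L n k)).re ≤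
      2 * ((H.groundStateFunctional (C0 * C0)).re + (H.groundStateFunctional (S1 * S1)).re) := by
    have hid := sub_sq_add_add_sq L n C0 S1
    have hpos : 0 ≤ (H.groundStateFunctional ((C0 + S1) * (C0 + S1))).re :=
      re_groundStateFunctional_mul_self_nonneg H
        ((realWave_isHermitian L n _ 0).add (realWave_isHermitian L n _ 1))
    have h2 := congrArg (fun O => (H.groundStateFunctional O).re) hid
    simp only [map_add, LinearMap.map_smul, smul_eq_mul, Complex.add_re, Complex.mul_re,
      Complex.re_ofNat, Complex.im_ofNat, zero_mul, sub_zero] at h2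
    rw [hA]
    linarith
  have hBsq : (H.groundStateFunctional (modeB L n k * modeB L n k)).re ≤
      2 * ((H.groundStateFunctional (S0 * S0)).re + (H.groundStateFunctional (C1 * C1)).re) := by
    have hid := sub_sq_add_add_sq L n S0 C1
    have hpos : 0 ≤ (H.groundStateFunctional ((S0 - C1) * (S0 - C1))).re :=
      re_groundStateFunctional_mul_self_nonneg H
        ((realWave_isHermitian L n _ 0).sub (realWave_isHermitian L n _ 1))
    have h2 := congrArg (fun O => (H.groundStateFunctional O).re) hid
    simp only [map_add, LinearMap.map_smul, smul_eq_mul, Complex.add_re, Complex.mul_re,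
      Complex.re_ofNat, Complex.im_ofNat, zero_mul, sub_zero] at h2
    rw [hB]
    linarith
  -- component 1 squares = component 0 squares
  have hC1' : (H.groundStateFunctional (C1 * C1)).re = (H.groundStateFunctional (C0 * C0)).re :=
    re_gsf_realWave_sq_one_eq_zero L n _
  have hS1' : (H.groundStateFunctional (S1 * S1)).re = (H.groundStateFunctional (S0 * S0)).re :=
    re_gsf_realWave_sq_one_eq_zero L n _
  have hmodes : (H.groundStateFunctional (C0 * C0)).re + (H.groundStateFunctional (S0 * S0)).re =
      xyStructureFactor 0 L n k * (L : ℝ) ^ 2 := re_gsf_cos_sq_add_sin_sq L n k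
  rw [e1]
  nlinarith [hAsq, hBsq, hC1', hS1', hmodes]

/-- Each square separately: `Re ω(B_{χ_k}B_{χ_k}ᴴ) ≤ 8 L² ĝ⁰(k)`. [folklore] -/
theorem re_gsf_charWave_mul_conjTranspose_le (k : TorusSite 2 L) :
    ((xyTorus 2 L n).groundStateFunctional
        (raiseWave L n (torusChar k) * (raiseWave L n (torusChar k))ᴴ)).re ≤
      8 * (L : ℝ) ^ 2 * xyStructureFactor 0 L n k := by
  have h := re_gsf_charWave_sum_le L n k
  have h' := re_gsf_conjTranspose_mul_self_nonneg L n (xyTorus 2 L n) (raiseWave L n (torusChar k))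
  linarith

/-- Each square separately: `Re ω(B_{χ_k}ᴴB_{χ_k}) ≤ 8 L² ĝ⁰(k)`. [folklore] -/
theorem re_gsf_conjTranspose_mul_charWave_le (k : TorusSite 2 L) :
    ((xyTorus 2 L n).groundStateFunctional
        ((raiseWave L n (torusChar k))ᴴ * raiseWave L n (torusChar k))).re ≤
      8 * (L : ℝ) ^ 2 * xyStructureFactor 0 L n k := by
  have h := re_gsf_charWave_sum_le L n k
  have h' := re_gsf_mul_conjTranspose_self_nonneg L n (xyTorus 2 L n) (raiseWave L n (torusChar k))
  linarith

/-! #### The engine inequality -/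

/-- **THE ENGINE.** For every spin `n/2`, side `L` and gauge `ψ` with `Σ_x e^{iψ_x} = 0`, if the
structure factor obeys `ĝ⁰(k) ≤ G` at every `k ≠ 0`, then the momentum-zero in-plane order parameter
of the tracial ground state of the TWISTED Hamiltonian `R_ψ H R_ψᴴ` obeys
`Σ_{x,y} Re ω_ψ(X_{xy}) ≤ 8 L² G`. No reflection symmetry, no flip symmetry and no value of the
unperturbed order parameter enter: only positivity, translation invariance and Parseval. [folklore] -/
theorem twisted_order_le (ψ : TorusSite 2 L → ℝ) (hψ0 : ∑ x, cexpGauge L ψ x = 0) {G : ℝ}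
    (hG : ∀ k : TorusSite 2 L, k ≠ 0 → xyStructureFactor 0 L n k ≤ G) :
    ∑ x : TorusSite 2 L, ∑ y : TorusSite 2 L,
      ((helixTwist n ψ * xyTorus 2 L n * (helixTwist n ψ)ᴴ).groundStateFunctional
        (xyPair n x y)).re ≤ 8 * (L : ℝ) ^ 2 * G := by
  set H := xyTorus 2 L n with hH
  set R := helixTwist n ψ with hR
  set f := cexpGauge L ψ with hf
  have hRR : R * Rᴴ = 1 := helixTwist_mul_conjTranspose n ψ
  have hRR' : Rᴴ * R = 1 := helixTwist_conjTranspose_mul n ψ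
  -- unitary conjugation
  have hconj : ∀ x y : TorusSite 2 L, (R * H * Rᴴ).groundStateFunctional (xyPair n x y) =
      H.groundStateFunctional (Rᴴ * xyPair n x y * R) := by
    intro x y
    have key := Matrix.groundStateFunctional_unitary_conj (A := H) hRR hRR' (Rᴴ * xyPair n x y * R)
    have e : R * (Rᴴ * xyPair n x y * R) * Rᴴ = xyPair n x y := by
      calc R * (Rᴴ * xyPair n x y * R) * Rᴴ = (R * Rᴴ) * xyPair n x y * (R * Rᴴ) := by
            simp only [mul_assoc]
        _ = xyPair n x y := by rw [hRR, one_mul, mul_one]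
    rw [e] at key
    exact key
  simp_rw [hconj]
  rw [show (∑ x : TorusSite 2 L, ∑ y : TorusSite 2 L,
      (H.groundStateFunctional (Rᴴ * xyPair n x y * R)).re) =
      (H.groundStateFunctional (∑ x : TorusSite 2 L, ∑ y : TorusSite 2 L,
        Rᴴ * xyPair n x y * R)).re by
    rw [map_sum, Complex.re_sum]
    refine Finset.sum_congr rfl fun x _ => ?_
    rw [map_sum, Complex.re_sum]]
  rw [hR, sum_sum_helixTwist_conj_xyPair, ← hf, LinearMap.map_smul, smul_eq_mul, map_add]
  -- the two diagonal sums
  have hunit : ∀ x, ‖f x‖ = 1 := fun x => by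
    rw [hf, cexpGauge, Complex.norm_exp_ofReal_mul_I]
  have hpars : ∑ k, ‖fourierCoeff L f k‖ ^ 2 = 1 := sum_norm_sq_fourierCoeff L hunit
  have ha0 : fourierCoeff L f 0 = 0 := by rw [fourierCoeff_zero, hψ0, mul_zero]
  have hG' : ∀ k : TorusSite 2 L, ‖fourierCoeff L f k‖ ^ 2 * (8 * (L : ℝ) ^ 2 * xyStructureFactor 0 L n k) ≤
      ‖fourierCoeff L f k‖ ^ 2 * (8 * (L : ℝ) ^ 2 * G) := by
    intro k
    by_cases hk : k = 0
    · rw [hk, ha0, norm_zero]; simp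
    · exact mul_le_mul_of_nonneg_left (by nlinarith [hG k hk, sq_nonneg (L : ℝ)]) (sq_nonneg _)
  have h1 : (H.groundStateFunctional (raiseWave L n f * (raiseWave L n f)ᴴ)).re ≤ 8 * (L : ℝ) ^ 2 * G := by
    rw [hH, gsf_raiseWave_mul_conjTranspose, Complex.re_sum]
    calc ∑ k : TorusSite 2 L, ((((‖fourierCoeff L f k‖ ^ 2 : ℝ)) : ℂ) *
          (xyTorus 2 L n).groundStateFunctional
            (raiseWave L n (torusChar k) * (raiseWave L n (torusChar k))ᴴ)).re
        ≤ ∑ k : TorusSite 2 L, ‖fourierCoeff L f k‖ ^ 2 * (8 * (L : ℝ) ^ 2 * G) := by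
          refine Finset.sum_le_sum fun k _ => ?_
          rw [Complex.re_ofReal_mul]
          exact (mul_le_mul_of_nonneg_left (re_gsf_charWave_mul_conjTranspose_le L n k)
            (sq_nonneg _)).trans (hG' k)
      _ = 8 * (L : ℝ) ^ 2 * G := by rw [← Finset.sum_mul, hpars, one_mul]
  have h2 : (H.groundStateFunctional ((raiseWave L n f)ᴴ * raiseWave L n f)).re ≤ 8 * (L : ℝ) ^ 2 * G := by
    rw [hH, gsf_conjTranspose_mul_raiseWave, Complex.re_sum]
    calc ∑ k : TorusSite 2 L, ((((‖fourierCoeff L f k‖ ^ 2 : ℝ)) : ℂ) *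
          (xyTorus 2 L n).groundStateFunctional
            ((raiseWave L n (torusChar k))ᴴ * raiseWave L n (torusChar k))).re
        ≤ ∑ k : TorusSite 2 L, ‖fourierCoeff L f k‖ ^ 2 * (8 * (L : ℝ) ^ 2 * G) := by
          refine Finset.sum_le_sum fun k _ => ?_
          rw [Complex.re_ofReal_mul]
          exact (mul_le_mul_of_nonneg_left (re_gsf_conjTranspose_mul_charWave_le L n k)
            (sq_nonneg _)).trans (hG' k)
      _ = 8 * (L : ℝ) ^ 2 * G := by rw [← Finset.sum_mul, hpars, one_mul]
  rw [Complex.mul_re, Complex.add_re]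
  simp only [Complex.div_re, Complex.one_re, Complex.re_ofNat, Complex.normSq_ofNat,
    Complex.div_im, Complex.one_im, Complex.im_ofNat, Complex.add_im]
  nlinarith [h1, h2]

end Modes


/-! ### Consequences of the Kennedy–Lieb–Shastry infrared bound at general spin -/

section Infrared

/-- `|e_α| ≤ S²` at every spin (`d = 2`). [folklore] -/
theorem abs_xyBondCorr_le_gen (α : Fin 3) (L : ℕ) [NeZero L] (n : ℕ) :
    |xyBondCorr (d := 2) α L n| ≤ ((n : ℝ) / 2) ^ 2 := by
  rw [xyBondCorr_of_neZero]
  have hL : (0 : ℝ) < L := by exact_mod_cast Nat.pos_of_ne_zero (NeZero.ne L)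
  have hden : (0 : ℝ) < ((2 : ℕ) : ℝ) * (L : ℝ) ^ 2 := by positivity
  rw [abs_div, abs_of_pos hden, div_le_iff₀ hden]
  have hcard : Fintype.card (TorusSite 2 L) = L ^ 2 := by simp [ZMod.card]
  calc |∑ x : TorusSite 2 L, ∑ i : Fin 2, xyGroundCorr α L n x (x + Pi.single i 1)|
      ≤ ∑ x : TorusSite 2 L, |∑ i : Fin 2, xyGroundCorr α L n x (x + Pi.single i 1)| :=
        Finset.abs_sum_le_sum_abs _ _
    _ ≤ ∑ x : TorusSite 2 L, ∑ i : Fin 2, |xyGroundCorr α L n x (x + Pi.single i 1)| :=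
        Finset.sum_le_sum fun x _ => Finset.abs_sum_le_sum_abs _ _
    _ ≤ ∑ x : TorusSite 2 L, ∑ i : Fin 2, ((n : ℝ) / 2) ^ 2 :=
        Finset.sum_le_sum fun x _ => Finset.sum_le_sum fun i _ =>
          xyGroundCorr_abs_le_holds α 2 L n x (x + Pi.single i 1)
    _ = ((n : ℝ) / 2) ^ 2 * (((2 : ℕ) : ℝ) * (L : ℝ) ^ 2) := by
        rw [Finset.sum_const, Finset.sum_const, Finset.card_univ, Finset.card_univ, Fintype.card_fin,
          hcard]
        simp only [nsmul_eq_mul]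
        push_cast
        ring

/-- `1 - cos(2π/L) ≥ 8/L²` for `L ≥ 2` (Jordan's inequality). [folklore] -/
theorem eight_div_sq_le_one_sub_cos (L : ℕ) (hL : 2 ≤ L) :
    8 / (L : ℝ) ^ 2 ≤ 1 - Real.cos (2 * Real.pi / L) := by
  have hLpos : (0 : ℝ) < L := by exact_mod_cast (by omega : 0 < L)
  have hL2 : (2 : ℝ) ≤ L := by exact_mod_cast hL
  have hx0 : 0 ≤ Real.pi / L := by positivity
  have hx1 : Real.pi / L ≤ Real.pi / 2 :=
    div_le_div_of_nonneg_left Real.pi_pos.le (by norm_num) hL2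
  have hsin := Real.mul_le_sin hx0 hx1
  have hcos : Real.cos (2 * Real.pi / L) = 1 - 2 * Real.sin (Real.pi / L) ^ 2 := by
    rw [show 2 * Real.pi / L = 2 * (Real.pi / L) by ring, Real.cos_two_mul, Real.cos_sq']
    ring
  have h2 : 2 / Real.pi * (Real.pi / L) = 2 / L := by
    field_simp
  rw [h2] at hsin
  have h0 : (0 : ℝ) ≤ 2 / L := by positivity
  have hsq : (2 / (L : ℝ)) ^ 2 ≤ Real.sin (Real.pi / L) ^ 2 := pow_le_pow_left₀ h0 hsin 2
  rw [hcos]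
  have : 8 / (L : ℝ) ^ 2 = 2 * (2 / (L : ℝ)) ^ 2 := by
    field_simp
    ring
  rw [this]
  linarith

/-- A nonzero residue has `cos(2π v/L) ≤ cos(2π/L)`. [folklore] -/
theorem cos_latticeMomentum_le {L : ℕ} [NeZero L] (hL : 2 ≤ L) {a : ZMod L} (ha : a ≠ 0) :
    Real.cos (2 * Real.pi * (a.val : ℝ) / L) ≤ Real.cos (2 * Real.pi / L) := by
  have hLpos : (0 : ℝ) < L := by exact_mod_cast (by omega : 0 < L)
  have hv1 : 1 ≤ a.val := Nat.one_le_iff_ne_zero.2 ((ZMod.val_ne_zero a).2 ha)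
  have hvL : a.val < L := ZMod.val_lt a
  have hv1' : (1 : ℝ) ≤ a.val := by exact_mod_cast hv1
  have hvL' : (a.val : ℝ) ≤ L - 1 := by
    have : a.val ≤ L - 1 := by omega
    have h := (Nat.cast_le (α := ℝ)).2 this
    rwa [Nat.cast_sub (by omega : 1 ≤ L), Nat.cast_one] at h
  have hlow : 2 * Real.pi / L ≤ 2 * Real.pi * (a.val : ℝ) / L := by
    rw [div_le_div_iff_of_pos_right hLpos]
    nlinarith [Real.pi_pos]
  rcases le_or_gt (2 * Real.pi * (a.val : ℝ) / L) Real.pi with hle | hgt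
  · exact Real.cos_le_cos_of_nonneg_of_le_pi (by positivity) hle hlow
  · -- reflect: `cos θ = cos (2π - θ)` with `2π - θ ∈ [2π/L, π)`
    rw [← Real.cos_two_pi_sub]
    have hup : 2 * Real.pi * (a.val : ℝ) / L ≤ 2 * Real.pi - 2 * Real.pi / L := by
      rw [div_le_iff₀ hLpos, sub_mul, div_mul_cancel₀ _ hLpos.ne']
      nlinarith [Real.pi_pos]
    exact Real.cos_le_cos_of_nonneg_of_le_pi (by positivity) (by linarith) (by linarith)

/-- Nonzero dual momenta have dispersion at least `1 - cos(2π/L)`. [folklore] -/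
theorem one_sub_cos_le_dispersion {L : ℕ} [NeZero L] (hL : 2 ≤ L) {q : TorusSite 2 L}
    (hq : q ≠ 0) : 1 - Real.cos (2 * Real.pi / L) ≤ dispersion (latticeMomentum L q) := by
  obtain ⟨i, hi⟩ : ∃ i, q i ≠ 0 := by
    by_contra h
    push Not at h
    exact hq (funext h)
  rw [dispersion]
  calc 1 - Real.cos (2 * Real.pi / L)
      ≤ 1 - Real.cos (latticeMomentum L q i) := by
        rw [latticeMomentum_apply]
        linarith [cos_latticeMomentum_le hL hi]
    _ ≤ ∑ j, (1 - Real.cos (latticeMomentum L q j)) :=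
        Finset.single_le_sum (f := fun j => 1 - Real.cos (latticeMomentum L q j))
          (fun j _ => by linarith [Real.cos_le_one (latticeMomentum L q j)]) (Finset.mem_univ i)

/-- **The structure factor away from zero momentum is `O(L)`**: on even tori `2k ≥ 4`, for every
spin `n/2 ≥ 1/2` and every `q ≠ 0`, `ĝ⁰(q) ≤ n·(2k)/5` (KLS infrared bound `ĝ² E_q ≤ S²` and
`E_q ≥ 8/L²`). [Kennedy–Lieb–Shastry 1988, eq. (4)] [folklore] -/
theorem xyStructureFactor_le_of_ne_zero {n : ℕ} (hn : 1 ≤ n) {k : ℕ} (hk : 2 ≤ k) [NeZero (2 * k)]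
    {q : TorusSite 2 (2 * k)} (hq : q ≠ 0) :
    xyStructureFactor 0 (2 * k) n q ≤ (n : ℝ) * ((2 * k : ℕ) : ℝ) / 5 := by
  obtain ⟨hg0, hb⟩ := kls_xy_infraredBound_ground_holds 2 le_rfl n hn k hk q hq
  set g := xyStructureFactor 0 (2 * k) n q with hg
  set Lr : ℝ := ((2 * k : ℕ) : ℝ) with hLr
  have hL2 : 2 ≤ 2 * k := by omega
  have hLr4 : (4 : ℝ) ≤ Lr := by rw [hLr]; exact_mod_cast (by omega : 4 ≤ 2 * k)
  have hn1 : (1 : ℝ) ≤ n := by exact_mod_cast hn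
  -- right-hand side of the infrared bound ≤ S²
  have hrhs : (1 / 4 : ℝ) * ∑ i : Fin 2, (xyBondCorr (d := 2) 0 (2 * k) n -
      xyBondCorr (d := 2) 2 (2 * k) n * Real.cos (latticeMomentum (2 * k) q i)) ≤
      ((n : ℝ) / 2) ^ 2 := by
    have h0 := abs_xyBondCorr_le_gen 0 (2 * k) n
    have h2 := abs_xyBondCorr_le_gen 2 (2 * k) n
    have hterm : ∀ i : Fin 2, xyBondCorr (d := 2) 0 (2 * k) n -
        xyBondCorr (d := 2) 2 (2 * k) n * Real.cos (latticeMomentum (2 * k) q i) ≤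
        2 * ((n : ℝ) / 2) ^ 2 := by
      intro i
      have hc := Real.abs_cos_le_one (latticeMomentum (2 * k) q i)
      have hprod : |xyBondCorr (d := 2) 2 (2 * k) n *
          Real.cos (latticeMomentum (2 * k) q i)| ≤ ((n : ℝ) / 2) ^ 2 := by
        rw [abs_mul]
        nlinarith [abs_nonneg (xyBondCorr (d := 2) 2 (2 * k) n), abs_nonneg
          (Real.cos (latticeMomentum (2 * k) q i))]
      linarith [(abs_le.1 h0).2, (abs_le.1 hprod).1]
    have hs : ∑ i : Fin 2, (xyBondCorr (d := 2) 0 (2 * k) n -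
        xyBondCorr (d := 2) 2 (2 * k) n * Real.cos (latticeMomentum (2 * k) q i)) ≤
        4 * ((n : ℝ) / 2) ^ 2 := by
      rw [Fin.sum_univ_two]; linarith [hterm 0, hterm 1]
    nlinarith
  have hE : 8 / Lr ^ 2 ≤ dispersion (latticeMomentum (2 * k) q) :=
    (eight_div_sq_le_one_sub_cos (2 * k) hL2).trans (one_sub_cos_le_dispersion hL2 hq)
  have hg2 : g ^ 2 * (8 / Lr ^ 2) ≤ ((n : ℝ) / 2) ^ 2 :=
    (mul_le_mul_of_nonneg_left hE (sq_nonneg g)).trans (hb.trans hrhs)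
  have hLpos : (0 : ℝ) < Lr := by linarith
  have hg2' : g ^ 2 * 32 ≤ (n : ℝ) ^ 2 * Lr ^ 2 := by
    have hLr2 : (0 : ℝ) < Lr ^ 2 := by positivity
    have h := mul_le_mul_of_nonneg_right hg2 hLr2.le
    rw [mul_assoc, div_mul_cancel₀ _ hLr2.ne'] at h
    nlinarith [h]
  by_contra hcon
  push Not at hcon
  have h25 : ((n : ℝ) * Lr / 5) ^ 2 < g ^ 2 := by
    exact pow_lt_pow_left₀ hcon (by positivity) two_ne_zero
  nlinarith [h25, hg2']

end Infrared

end XYGaugeTwist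

end Literature.MathematicalPhysics.QuantumLattice
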